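import Literature.Topology.FourManifolds.MMSWRasmussenFiniteApproxProofs
import Literature.Topology.FourManifolds.GaussDiagramsRegularPosition
import HarnessLib

/-!
# General position of the standard picture of a model knot

Sibling of `MMSWRasmussen.lean` and `MMSWRasmussenFiniteApproxProofs.lean`, towards the named
fact `Literature.Topology.FourManifolds.MMSW.eventually_approxHasRasmussen` (Manolescu–Marengon–
Sarkar–Willis, Duke Math. J. 172 (2023), arXiv:1910.08195, Thm. 1.4 / Prop. 8.2 (i)): the first
step of MMSW §8.1 — *"draw the link in the standard picture of `#ʳ(S¹ × S²)` in general
position"* — carried out inside the tree's model.  For a model knot `K ⊂ M_r = ∂D_r` missing the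
core circles there is a collared smooth isotopy `H` through core-missing model knots from `K` to a
knot `K' = H 1` whose standard picture `D(0⃗)(K') = finiteApprox r 0 K' : 𝕊¹ → 𝕊³` IS a knot of the
tree in general position with respect to the stereographic projection
(`Knot.InGeneralPosition`: regular plane curve, transverse double points, no triple points), so
that its Gauss diagram is read off from its own double points
(`Knot.InGeneralPosition.hasGaussDiagram`) and all the finite approximations `D(k⃗)(K)` and
`D(k⃗)(K')` have the same Rasmussen invariants (`approxHasRasmussen_iff_of_isotopy`).

## The argument

The standard picture `draw : M_r ∖ {cores} → ℝ² × ℝ` is a diffeomorphism onto the open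
**picture region** `V_r` (`pictureRegion`, `isOpen_pictureRegion`) with inverse the **chart lift**
`chartLift` (`draw_chartLift`, `chartLift_draw`, `contDiffAt_chartLift`,
`chartLift_mem_modelBoundary`): explicitly `V_r = {(P, h) : P ≠ 0, g_r(z) < 1, |z - c_j|² > 1}`
with `z = (|P| - C_r) + i h`, and the lift is `(z, √(1 - g_r(z)) · P̄/|P|)`.  The chart curve of
the picture knot `K₃` (`⇑K₃ = finiteApprox r 0 K`) is `θ ↦ draw (K (cos θ, sin θ))`
(`stereoCurve_eq_draw`), a compact subset of `V_r`, so it has a uniform distance `δ` to the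
complement (`IsCompact.exists_thickening_subset_open`).  The tree's genericity pipeline
(`GaussDiagramsPerturbation`, `GaussDiagramsTransverse`, `GaussDiagramsRegularPosition`) gives a
first-harmonic perturbation `P θ = (cos θ • v + sin θ • w, 0)` below both `δ` and the
`C¹`-stability bound of `K₃` (`Knot.exists_forall_pertFamily_regular`) with generic plane curve
(`exists_pert_generic`); the straight-line family of chart curves `draw ∘ K + u P`, `u ∈ [0, 1]`,
stays in `V_r`, consists of regular simple closed curves, and lifts by `chartLift` to the isotopy
`H` of model knots (`gpFamily`); its end `K'` has picture the perturbed knot `Knot.pertKnot`, in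
general position by `Knot.inGeneralPosition_of_generic`.

Everything is proved; no named facts; definitions: `chartC`, `chartZ`, `pictureRegion`,
`chartLift`, `gpFamily`.

## References

* C. Manolescu, M. Marengon, S. Sarkar, M. Willis, Duke Math. J. 172 (2023) 231–311,
  arXiv:1910.08195, §8.1 and Prop. 8.2. [ManolescuMarengonSarkarWillis2023]
* R. Kirby, *The Topology of 4-Manifolds*, LNM 1374 (1989), Ch. I §2 (the standard picture).
  [Kirby1989]
* M. W. Hirsch, *Differential Topology*, GTM 33 (1976), Ch. 2 §1 Lemma 1.3, Ch. 3 Thm. 2.4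
  (stability of embeddings, general position). [HirschDT1976]
* P. R. Cromwell, *Knots and Links* (2004), Thm. 3.2.1 (regular projections). [Cromwell2004]
-/

open scoped Manifold ContDiff Topology ComplexConjugate Real
open Function Set Complex

noncomputable section

namespace Literature.Topology.FourManifolds

/-- Local notation: `𝔼 n` is the model Euclidean space `EuclideanSpace ℝ (Fin n)`. -/
local notation "𝔼 " n:arg => EuclideanSpace ℝ (Fin n)

/-- Local notation: `𝕊 n` is the unit sphere in `EuclideanSpace ℝ (Fin (n + 1))`. -/
local notation "𝕊 " n:arg => (Metric.sphere (0 : EuclideanSpace ℝ (Fin (n + 1))) 1)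

attribute [local instance] fact_finrank_euclideanSpace_two fact_finrank_euclideanSpace_four

namespace MMSW

open Literature.AlgebraicTopology.Homotopy.HopfFibration (zC wC ofZW zC_ofZW wC_ofZW ofZW_zC_wC)

variable {r : ℕ}

/-! ## The chart of the standard picture: the picture region and the chart lift -/

/-- The planar point of a chart point `((a, b), h)` as a complex number `a + i b`. [folklore] -/
def chartC (y : (ℝ × ℝ) × ℝ) : ℂ :=
  ((y.1.1 : ℝ) : ℂ) + ((y.1.2 : ℝ) : ℂ) * I

/-- The `z`-coordinate read off a chart point: `z = (|P| - C_r) + i h`. [folklore] -/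
def chartZ (r : ℕ) (y : (ℝ × ℝ) × ℝ) : ℂ :=
  ((‖chartC y‖ - drawRadius r : ℝ) : ℂ) + ((y.2 : ℝ) : ℂ) * I

/-- **The picture region** `V_r ⊆ ℝ² × ℝ`: chart points off the axis whose `z` lies strictly
inside the guards and has `g_r(z) < 1` — the image of `M_r ∖ {cores}` under the standard picture
(`draw_mem_pictureRegion`, `draw_chartLift`). [cite: Kirby1989, Ch. I §2] -/
def pictureRegion (r : ℕ) : Set ((ℝ × ℝ) × ℝ) :=
  {y | chartC y ≠ 0 ∧ (∀ j : Fin r, 1 < Complex.normSq (chartZ r y - holeCentre r j)) ∧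
    planarPot r (chartZ r y) < 1}

/-- **The chart lift** `V_r → M_r ∖ {cores}`: `(P, h) ↦ (z, √(1 - g_r(z)) · P̄/|P|)`,
`z = (|P| - C_r) + i h` — the inverse of the standard picture (`unpicture r 0` after the inverse
stereographic map). [cite: Kirby1989, Ch. I §2] -/
def chartLift (r : ℕ) (y : (ℝ × ℝ) × ℝ) : 𝔼 4 :=
  unpicture r 0 (stereoNorthInvCoe y)

/-- Real part of `chartC`. [folklore] -/
@[simp] theorem chartC_re (y : (ℝ × ℝ) × ℝ) : (chartC y).re = y.1.1 := by
  simp [chartC]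

/-- Imaginary part of `chartC`. [folklore] -/
@[simp] theorem chartC_im (y : (ℝ × ℝ) × ℝ) : (chartC y).im = y.1.2 := by
  simp [chartC]

/-- Imaginary part of `chartZ` (the height). [folklore] -/
@[simp] theorem chartZ_im (y : (ℝ × ℝ) × ℝ) : (chartZ r y).im = y.2 := by
  simp [chartZ]

/-- Real part of `chartZ`. [folklore] -/
@[simp] theorem chartZ_re (y : (ℝ × ℝ) × ℝ) : (chartZ r y).re = ‖chartC y‖ - drawRadius r := by
  simp [chartZ]

/-- The two inverse stereographic maps of the tree agree: `stereoNorthInvCoe y` of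
`GaussDiagramsChart` is `toSphereThree y.1 y.2` of `MMSWRasmussen`. [folklore] -/
theorem stereoNorthInvCoe_eq_coe_toSphereThree (y : (ℝ × ℝ) × ℝ) :
    stereoNorthInvCoe y = ((toSphereThree y.1 y.2 : 𝕊 3) : 𝔼 4) := by
  have hS : y.1.1 ^ 2 + y.1.2 ^ 2 + y.2 ^ 2 + 1 ≠ 0 := by positivity
  ext i
  fin_cases i <;> simp [stereoNorthInvCoe, coe_toSphereThree, stereoNorthRadSq] <;>
    field_simp

/-- `toSphereThree y.1 y.2 = stereoNorthInv y`. [folklore] -/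
theorem toSphereThree_eq_stereoNorthInv (y : (ℝ × ℝ) × ℝ) :
    toSphereThree y.1 y.2 = stereoNorthInv y :=
  Subtype.ext (by rw [coe_stereoNorthInv, stereoNorthInvCoe_eq_coe_toSphereThree])

/-- `toSphereThree` misses the north pole. [folklore] -/
theorem toSphereThree_ne_northPole (p : ℝ × ℝ) (h : ℝ) : toSphereThree p h ≠ northPole := by
  rw [show toSphereThree p h = toSphereThree (p, h).1 (p, h).2 from rfl,
    toSphereThree_eq_stereoNorthInv]
  exact stereoNorthInv_ne_northPole _

/-- The planar stereographic coordinate of the lifted chart point is `chartC`. [folklore] -/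
theorem stereoC_stereoNorthInvCoe (y : (ℝ × ℝ) × ℝ) : stereoC (stereoNorthInvCoe y) = chartC y := by
  rw [stereoNorthInvCoe_eq_coe_toSphereThree, stereoC_toSphereThree, chartC]

/-- The stereographic height of the lifted chart point is `y.2`. [folklore] -/
theorem stereoH_stereoNorthInvCoe (y : (ℝ × ℝ) × ℝ) : stereoH (stereoNorthInvCoe y) = y.2 := by
  rw [stereoNorthInvCoe_eq_coe_toSphereThree, stereoH_toSphereThree]

/-- `liftZ` of the lifted chart point is `chartZ`. [folklore] -/
theorem liftZ_stereoNorthInvCoe (y : (ℝ × ℝ) × ℝ) : liftZ r (stereoNorthInvCoe y) = chartZ r y := by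
  rw [liftZ, stereoC_stereoNorthInvCoe, stereoH_stereoNorthInvCoe, chartZ]

/-- The `z`-coordinate of the chart lift. [folklore] -/
@[simp] theorem zC_chartLift (y : (ℝ × ℝ) × ℝ) : zC (chartLift r y) = chartZ r y := by
  rw [chartLift, unpicture, neg_zero, sphereTwist_zero, zC_ofZW, liftZ_stereoNorthInvCoe]

/-- The `w`-coordinate of the chart lift: `√(1 - g_r(z)) · P̄/|P|`. [folklore] -/
theorem wC_chartLift (y : (ℝ × ℝ) × ℝ) :
    wC (chartLift r y) = ((Real.sqrt (1 - planarPot r (chartZ r y)) : ℝ) : ℂ) *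
      (conj (chartC y) / ((‖chartC y‖ : ℝ) : ℂ)) := by
  rw [chartLift, unpicture, neg_zero, sphereTwist_zero, wC_ofZW, liftW, liftZ_stereoNorthInvCoe,
    stereoC_stereoNorthInvCoe]

/-- `|w|² = 1 - g_r(z)` for the chart lift of a point of the picture region. [folklore] -/
theorem normSq_wC_chartLift {y : (ℝ × ℝ) × ℝ} (hy : y ∈ pictureRegion r) :
    Complex.normSq (wC (chartLift r y)) = 1 - planarPot r (chartZ r y) := by
  have hP : ‖chartC y‖ ≠ 0 := norm_ne_zero_iff.2 hy.1
  have hg : 0 ≤ 1 - planarPot r (chartZ r y) := by linarith [hy.2.2]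
  rw [wC_chartLift, map_mul, map_div₀, Complex.normSq_ofReal, Complex.normSq_conj,
    Complex.normSq_ofReal, Complex.normSq_eq_norm_sq, Real.mul_self_sqrt hg]
  field_simp

/-- The chart lift of a point of the picture region misses the cores. [folklore] -/
theorem wC_chartLift_ne_zero {y : (ℝ × ℝ) × ℝ} (hy : y ∈ pictureRegion r) :
    wC (chartLift r y) ≠ 0 := by
  intro h
  have := normSq_wC_chartLift hy
  rw [h, map_zero] at this
  linarith [hy.2.2]

/-- **The chart lift lands in the model boundary** (guard `|z - c_j|² ≥ 1` and
`G_r = g_r(z) + |w|² = 1`). [folklore] -/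
theorem chartLift_mem_modelBoundary {y : (ℝ × ℝ) × ℝ} (hy : y ∈ pictureRegion r) :
    chartLift r y ∈ modelBoundary r := by
  refine ⟨fun j ↦ ?_, ?_⟩
  · rw [holeTerm_eq_normSq, zC_chartLift]
    exact (hy.2.1 j).le
  · rw [levelFun_eq_planarPot_add, normSq_wC_chartLift hy, zC_chartLift]
    ring

/-- **The standard picture inverts the chart lift on the picture region**: `draw ∘ chartLift = id`
on `V_r`. [cite: Kirby1989, Ch. I §2] -/
theorem draw_chartLift {y : (ℝ × ℝ) × ℝ} (hy : y ∈ pictureRegion r) : draw r (chartLift r y) = y := by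
  have hP : ‖chartC y‖ ≠ 0 := norm_ne_zero_iff.2 hy.1
  have hP' : ((‖chartC y‖ : ℝ) : ℂ) ≠ 0 := by exact_mod_cast hP
  have hg : 0 < 1 - planarPot r (chartZ r y) := by linarith [hy.2.2]
  have hs : Real.sqrt (1 - planarPot r (chartZ r y)) ≠ 0 := (Real.sqrt_pos.2 hg).ne'
  have hs' : ((Real.sqrt (1 - planarPot r (chartZ r y)) : ℝ) : ℂ) ≠ 0 := by exact_mod_cast hs
  have hw := wC_chartLift (r := r) y
  have hwn : ‖wC (chartLift r y)‖ = Real.sqrt (1 - planarPot r (chartZ r y)) := by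
    rw [hw, norm_mul, norm_div, Complex.norm_real, Complex.norm_conj, Complex.norm_real,
      Real.norm_eq_abs, Real.norm_eq_abs, abs_of_nonneg (Real.sqrt_nonneg _),
      abs_of_nonneg (norm_nonneg _), div_self hP, mul_one]
  have hC : drawC r (chartLift r y) = chartC y := by
    rw [drawC, hwn, zC_chartLift, chartZ_re, sub_add_cancel, hw, map_mul, Complex.conj_ofReal,
      map_div₀, Complex.conj_conj, Complex.conj_ofReal]
    field_simp
  simp only [draw, hC, chartC_re, chartC_im, zC_chartLift, chartZ_im]

/-- **The chart lift is smooth on the picture region.** [folklore] -/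
theorem contDiffAt_chartLift {y : (ℝ × ℝ) × ℝ} (hy : y ∈ pictureRegion r) :
    ContDiffAt ℝ ∞ (chartLift r) y := by
  have h3 : 1 - stereoNorthInvCoe y 3 ≠ 0 :=
    (sub_pos.2 (stereoNorthInvCoe_apply_three_lt_one y)).ne'
  have hP : stereoC (stereoNorthInvCoe y) ≠ 0 := by
    rw [stereoC_stereoNorthInvCoe]; exact hy.1
  have hz : ∀ j : Fin r, liftZ r (stereoNorthInvCoe y) ≠ holeCentre r j := fun j h ↦ by
    have := hy.2.1 j
    rw [← liftZ_stereoNorthInvCoe, h, sub_self, map_zero] at this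
    exact absurd this (by norm_num)
  have hpot : 1 - planarPot r (liftZ r (stereoNorthInvCoe y)) ≠ 0 := by
    rw [liftZ_stereoNorthInvCoe]
    linarith [hy.2.2]
  exact (contDiffAt_unpicture h3 hP hz hpot 0).comp y contDiff_stereoNorthInvCoe.contDiffAt

/-- The finite approximation map at `k = 0` is `toSphereThree ∘ draw`. [folklore] -/
theorem approxMap_zero (x : 𝔼 4) : approxMap r 0 x = toSphereThree (draw r x).1 (draw r x).2 := by
  simp [approxMap]

/-- The inverse stereographic map of the picture of `x` is `approxMap r 0 x`. [folklore] -/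
theorem stereoNorthInvCoe_draw (x : 𝔼 4) :
    stereoNorthInvCoe (draw r x) = ((approxMap r 0 x : 𝕊 3) : 𝔼 4) := by
  rw [stereoNorthInvCoe_eq_coe_toSphereThree, approxMap_zero]

/-- **The chart lift inverts the standard picture on `M_r ∖ {cores}`**: `chartLift ∘ draw = id`
there. [cite: Kirby1989, Ch. I §2] -/
theorem chartLift_draw {x : 𝔼 4} (hx : x ∈ modelBoundary r) (hw : wC x ≠ 0) :
    chartLift r (draw r x) = x := by
  rw [chartLift, stereoNorthInvCoe_draw, unpicture_coe_approxMap hx hw 0]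

/-- `chartZ` of the picture of a point of `M_r` off the cores is its `z`. [folklore] -/
theorem chartZ_draw {x : 𝔼 4} (hx : x ∈ modelBoundary r) (hw : wC x ≠ 0) :
    chartZ r (draw r x) = zC x := by
  rw [← liftZ_stereoNorthInvCoe, stereoNorthInvCoe_draw, liftZ_coe_approxMap hx hw 0]

/-- `chartC` of the picture of a point is its planar position `drawC`. [folklore] -/
theorem chartC_draw (x : 𝔼 4) : chartC (draw r x) = drawC r x := by
  apply Complex.ext <;> simp [draw]

/-- **The standard picture of `M_r ∖ {cores}` lies in the picture region.** [folklore] -/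
theorem draw_mem_pictureRegion {x : 𝔼 4} (hx : x ∈ modelBoundary r) (hw : wC x ≠ 0) :
    draw r x ∈ pictureRegion r := by
  have hR : 0 < (zC x).re + drawRadius r := re_zC_add_drawRadius_pos hx
  have hpot : planarPot r (zC x) < 1 := by
    have h := one_sub_planarPot_zC hx
    have hpos : 0 < Complex.normSq (wC x) := Complex.normSq_pos.2 hw
    linarith
  refine ⟨?_, fun j ↦ ?_, ?_⟩
  · rw [chartC_draw, ← norm_ne_zero_iff, norm_drawC hw hR]
    exact hR.ne'
  · rw [chartZ_draw hx hw, ← holeTerm_eq_normSq]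
    refine lt_of_le_of_ne (hx.1 j) fun h1 ↦ ?_
    -- `|z - c_j|² = 1` would force `g_r(z) ≥ 1`
    have hle : (1 : ℝ) ≤ planarPot r (zC x) := by
      rw [planarPot]
      have hsum : 1 / Complex.normSq (zC x - holeCentre r j) ≤
          ∑ i : Fin r, 1 / Complex.normSq (zC x - holeCentre r i) :=
        Finset.single_le_sum (f := fun i ↦ 1 / Complex.normSq (zC x - holeCentre r i))
          (fun i _ ↦ one_div_nonneg.2 (Complex.normSq_nonneg _)) (Finset.mem_univ j)
      rw [← holeTerm_eq_normSq, ← h1, div_one] at hsum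
      have h0 : 0 ≤ Complex.normSq (zC x) / (40 * ((r : ℝ) + 1)) ^ 2 :=
        div_nonneg (Complex.normSq_nonneg _) (by positivity)
      linarith
    linarith
  · rwa [chartZ_draw hx hw]

/-- **The picture region is open.** [folklore] -/
theorem isOpen_pictureRegion : IsOpen (pictureRegion r) := by
  have hC : Continuous chartC := by unfold chartC; fun_prop
  have hZ : Continuous (chartZ r) := by unfold chartZ; fun_prop
  -- the part not involving the potential
  set U : Set ((ℝ × ℝ) × ℝ) :=
    {y | chartC y ≠ 0 ∧ ∀ j : Fin r, 1 < Complex.normSq (chartZ r y - holeCentre r j)} with hU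
  have hUo : IsOpen U := by
    rw [hU, Set.setOf_and, Set.setOf_forall]
    exact (isOpen_ne_fun hC continuous_const).inter (isOpen_iInter_of_finite fun j ↦
      isOpen_lt continuous_const (Complex.continuous_normSq.comp (hZ.sub continuous_const)))
  -- on `U` the potential is continuous
  have hcont : ContinuousOn (fun y ↦ planarPot r (chartZ r y)) U := by
    intro y hy
    have hz : ∀ j : Fin r, chartZ r y ≠ holeCentre r j := fun j h ↦ by
      have := hy.2 j
      rw [h, sub_self, map_zero] at this
      exact absurd this (by norm_num)
    exact ((contDiffAt_planarPot hz (n := 0)).continuousAt.comp hZ.continuousAt).continuousWithinAt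
  have heq : pictureRegion r = U ∩ (fun y ↦ planarPot r (chartZ r y)) ⁻¹' Iio 1 := by
    ext y
    simp only [pictureRegion, hU, mem_setOf_eq, mem_inter_iff, mem_preimage, mem_Iio, and_assoc]
  rw [heq]
  exact hcont.isOpen_inter_preimage hUo isOpen_Iio

/-! ## The chart curve of the standard picture -/

/-- `D(0⃗)` pointwise: `finiteApprox r 0 K t = toSphereThree (draw (K t))`. [folklore] -/
theorem finiteApprox_zero_apply (K : 𝕊 1 → 𝔼 4) (t : 𝕊 1) :
    finiteApprox r 0 K t = toSphereThree (draw r (K t)).1 (draw r (K t)).2 := by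
  simp [finiteApprox]

/-- A knot whose underlying map is a finite approximation misses the north pole. [folklore] -/
theorem ne_northPole_of_coe_eq_finiteApprox {K : 𝕊 1 → 𝔼 4} {K₃ : Knot} {k : ℤ}
    (hK₃ : ⇑K₃ = finiteApprox r k K) (x : 𝕊 1) : K₃ x ≠ northPole := by
  rw [show K₃ x = finiteApprox r k K x from congrFun hK₃ x]
  exact toSphereThree_ne_northPole _ _

/-- **The chart curve of the picture knot is the standard picture**: if `⇑K₃ = D(0⃗)(K)` then
`stereoCurve K₃ θ = draw (K (cos θ, sin θ))`. [folklore] -/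
theorem stereoCurve_eq_draw {K : 𝕊 1 → 𝔼 4} {K₃ : Knot} (hK₃ : ⇑K₃ = finiteApprox r 0 K)
    (θ : ℝ) : K₃.stereoCurve θ = draw r (K (circlePoint θ)) := by
  rw [Knot.stereoCurve_apply, SphereEmbedding.curve_apply,
    show K₃ (circlePoint θ) = finiteApprox r 0 K (circlePoint θ) from congrFun hK₃ _,
    finiteApprox_zero_apply, stereoNorthCoords_coe, planarProjection_toSphereThree,
    height_toSphereThree]

/-- **A uniform margin**: the chart curve of the picture of a core-missing model knot keeps a
positive distance `δ` from the complement of the (open) picture region — it is a compact subset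
of it. [folklore] -/
theorem exists_forall_stereoCurve_add_mem {K : 𝕊 1 → 𝔼 4} (hK : IsModelKnot r K)
    (hw : ∀ t, wC (K t) ≠ 0) {K₃ : Knot} (hK₃ : ⇑K₃ = finiteApprox r 0 K) :
    ∃ δ > 0, ∀ (θ : ℝ) (v : (ℝ × ℝ) × ℝ), ‖v‖ < δ → K₃.stereoCurve θ + v ∈ pictureRegion r := by
  have hK₃0 : ∀ x, K₃ x ≠ northPole := ne_northPole_of_coe_eq_finiteApprox hK₃
  set S : Set ((ℝ × ℝ) × ℝ) := K₃.stereoCurve '' Icc 0 (2 * Real.pi) with hS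
  have hSc : IsCompact S := isCompact_Icc.image (Knot.continuous_stereoCurve hK₃0)
  have hsub : S ⊆ pictureRegion r := by
    rintro _ ⟨θ, _, rfl⟩
    rw [stereoCurve_eq_draw hK₃]
    exact draw_mem_pictureRegion (hK.2.2.2 _) (hw _)
  obtain ⟨δ, hδ, hthick⟩ := hSc.exists_thickening_subset_open isOpen_pictureRegion hsub
  refine ⟨δ, hδ, fun θ v hv ↦ hthick ?_⟩
  obtain ⟨θ', hθ', heq⟩ := K₃.periodic_stereoCurve.exists_mem_Ico₀ Real.two_pi_pos θ
  rw [Metric.mem_thickening_iff]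
  refine ⟨K₃.stereoCurve θ', ⟨θ', Ico_subset_Icc_self hθ', rfl⟩, ?_⟩
  rw [← heq, dist_eq_norm, add_sub_cancel_left]
  exact hv

/-! ## The perturbation family lifted to the model -/

/-- The first-harmonic perturbation term at a point of the circle: `(t₀ • v + t₁ • w, 0)`
(plane part perturbed, height kept). [folklore] -/
def pertVec (q : (ℝ × ℝ) × (ℝ × ℝ)) (t : 𝕊 1) : (ℝ × ℝ) × ℝ :=
  (((t : 𝔼 2) 0) • q.1 + ((t : 𝔼 2) 1) • q.2, 0)

/-- At `(cos θ, sin θ)` the perturbation term is the tree's `pertTerm γ q θ` (for any plane curve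
`γ`). [folklore] -/
theorem pertVec_circlePoint (γ : ℝ → ℝ × ℝ) (q : (ℝ × ℝ) × (ℝ × ℝ)) (θ : ℝ) :
    pertVec q (circlePoint θ) = Knot.pertTerm γ q θ := by
  simp only [pertVec, circlePoint_apply_zero, circlePoint_apply_one, Knot.pertTerm, pert]
  congr 1
  abel

/-- The size of the perturbation term: `‖pertVec q t‖ ≤ ‖v‖ + ‖w‖`. [folklore] -/
theorem norm_pertVec_le (K₃ : Knot) (q : (ℝ × ℝ) × (ℝ × ℝ)) (t : 𝕊 1) :
    ‖pertVec q t‖ ≤ ‖q.1‖ + ‖q.2‖ := by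
  obtain ⟨θ, rfl⟩ := circlePoint_surjective t
  rw [pertVec_circlePoint K₃.planeCurve]
  exact Knot.norm_pertTerm_le K₃ q θ

/-- **The general-position family** of a model knot: lift the straight-line family of chart
curves `draw ∘ K + χ(s) · pertVec q` (`χ = Real.smoothTransition`) back to `M_r` by the chart
lift. [folklore] -/
def gpFamily (r : ℕ) (K : 𝕊 1 → 𝔼 4) (q : (ℝ × ℝ) × (ℝ × ℝ)) (s : ℝ) (t : 𝕊 1) : 𝔼 4 :=
  chartLift r (draw r (K t) + Real.smoothTransition s • pertVec q t)

/-- Over an angle the chart point of the family is the tree's straight-line family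
`Knot.pertFamily K₃ (pertTerm K₃.planeCurve q) (χ s) θ`. [folklore] -/
theorem draw_add_smul_pertVec_circlePoint {K : 𝕊 1 → 𝔼 4} {K₃ : Knot}
    (hK₃ : ⇑K₃ = finiteApprox r 0 K) (q : (ℝ × ℝ) × (ℝ × ℝ)) (u θ : ℝ) :
    draw r (K (circlePoint θ)) + u • pertVec q (circlePoint θ) =
      Knot.pertFamily K₃ (Knot.pertTerm K₃.planeCurve q) u θ := by
  rw [Knot.pertFamily, stereoCurve_eq_draw hK₃, pertVec_circlePoint K₃.planeCurve]

/-- The family over an angle: `gpFamily r K q s (cos θ, sin θ) = chartLift (pertFamily … (χ s) θ)`.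
[folklore] -/
theorem gpFamily_circlePoint {K : 𝕊 1 → 𝔼 4} {K₃ : Knot} (hK₃ : ⇑K₃ = finiteApprox r 0 K)
    (q : (ℝ × ℝ) × (ℝ × ℝ)) (s θ : ℝ) :
    gpFamily r K q s (circlePoint θ) =
      chartLift r (Knot.pertFamily K₃ (Knot.pertTerm K₃.planeCurve q)
        (Real.smoothTransition s) θ) := by
  rw [gpFamily, draw_add_smul_pertVec_circlePoint hK₃]

/-- At `s ≤ 0` the family is `K` (`χ(s) = 0` and `chartLift ∘ draw = id`). [folklore] -/
theorem gpFamily_of_nonpos {K : 𝕊 1 → 𝔼 4} (hK : IsModelKnot r K) (hw : ∀ t, wC (K t) ≠ 0)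
    (q : (ℝ × ℝ) × (ℝ × ℝ)) {s : ℝ} (hs : s ≤ 0) : gpFamily r K q s = K := by
  funext t
  rw [gpFamily, Real.smoothTransition.zero_of_nonpos hs, zero_smul, add_zero,
    chartLift_draw (hK.2.2.2 t) (hw t)]

/-- At `s ≥ 1` the family is its end stage (`χ(s) = 1`). [folklore] -/
theorem gpFamily_of_one_le (K : 𝕊 1 → 𝔼 4) (q : (ℝ × ℝ) × (ℝ × ℝ)) {s : ℝ} (hs : 1 ≤ s) :
    gpFamily r K q s = gpFamily r K q 1 := by
  funext t
  rw [gpFamily, gpFamily, Real.smoothTransition.one_of_one_le hs,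
    Real.smoothTransition.one_of_one_le le_rfl]

/-- **The chart points of the family stay in the picture region** when the perturbation is
below the uniform margin `δ`. [folklore] -/
theorem draw_add_smul_pertVec_mem {K : 𝕊 1 → 𝔼 4} {K₃ : Knot} (hK₃ : ⇑K₃ = finiteApprox r 0 K)
    {δ : ℝ} (hδ : ∀ (θ : ℝ) (v : (ℝ × ℝ) × ℝ), ‖v‖ < δ → K₃.stereoCurve θ + v ∈ pictureRegion r)
    {q : (ℝ × ℝ) × (ℝ × ℝ)} (hq : ‖q.1‖ + ‖q.2‖ < δ) (s : ℝ) (t : 𝕊 1) :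
    draw r (K t) + Real.smoothTransition s • pertVec q t ∈ pictureRegion r := by
  obtain ⟨θ, rfl⟩ := circlePoint_surjective t
  rw [← stereoCurve_eq_draw hK₃]
  refine hδ θ _ (lt_of_le_of_lt ?_ hq)
  rw [norm_smul, Real.norm_eq_abs, abs_of_nonneg (Real.smoothTransition.nonneg s)]
  exact (mul_le_of_le_one_left (norm_nonneg _) (Real.smoothTransition.le_one s)).trans
    (norm_pertVec_le K₃ q _)

/-- The chart-point map `(s, t) ↦ draw (K t) + χ(s) • pertVec q t` is jointly smooth on
`ℝ × 𝕊¹` for a core-missing model knot. [folklore] -/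
theorem contMDiff_draw_add_smul_pertVec {K : 𝕊 1 → 𝔼 4} (hK : IsModelKnot r K)
    (hw : ∀ t, wC (K t) ≠ 0) (q : (ℝ × ℝ) × (ℝ × ℝ)) :
    ContMDiff (𝓘(ℝ, ℝ).prod (𝓡 1)) 𝓘(ℝ, (ℝ × ℝ) × ℝ) ∞
      (fun p : ℝ × (𝕊 1) ↦ draw r (K p.2) + Real.smoothTransition p.1 • pertVec q p.2) := by
  have hKd : ContMDiff (𝓡 1) 𝓘(ℝ, (ℝ × ℝ) × ℝ) ∞ (fun t : 𝕊 1 ↦ draw r (K t)) := fun t ↦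
    (contDiffAt_draw (hw t)).contMDiffAt.comp t (hK.1 t)
  have hcoord : ∀ i : Fin 2, ContMDiff (𝓡 1) 𝓘(ℝ, ℝ) ∞ (fun t : 𝕊 1 ↦ (t : 𝔼 2) i) := fun i ↦
    (EuclideanSpace.proj i).contDiff.comp_contMDiff contMDiff_coe_sphere
  have hpv : ContMDiff (𝓡 1) 𝓘(ℝ, (ℝ × ℝ) × ℝ) ∞ (pertVec q) :=
    (((hcoord 0).smul contMDiff_const).add ((hcoord 1).smul contMDiff_const)).prodMk_space
      contMDiff_const
  have hχ : ContMDiff (𝓘(ℝ, ℝ).prod (𝓡 1)) 𝓘(ℝ, ℝ) ∞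
      (fun p : ℝ × (𝕊 1) ↦ Real.smoothTransition p.1) :=
    Real.smoothTransition.contDiff.comp_contMDiff contMDiff_fst
  exact (hKd.comp contMDiff_snd).add (hχ.smul (hpv.comp contMDiff_snd))

/-- **The family is jointly smooth** on `ℝ × 𝕊¹` (below the margin `δ`). [folklore] -/
theorem contMDiff_gpFamily {K : 𝕊 1 → 𝔼 4} (hK : IsModelKnot r K) (hw : ∀ t, wC (K t) ≠ 0)
    {K₃ : Knot} (hK₃ : ⇑K₃ = finiteApprox r 0 K) {δ : ℝ}
    (hδ : ∀ (θ : ℝ) (v : (ℝ × ℝ) × ℝ), ‖v‖ < δ → K₃.stereoCurve θ + v ∈ pictureRegion r)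
    {q : (ℝ × ℝ) × (ℝ × ℝ)} (hq : ‖q.1‖ + ‖q.2‖ < δ) :
    ContMDiff (𝓘(ℝ, ℝ).prod (𝓡 1)) 𝓘(ℝ, 𝔼 4) ∞
      (fun p : ℝ × (𝕊 1) ↦ gpFamily r K q p.1 p.2) := fun p ↦
  (contDiffAt_chartLift (draw_add_smul_pertVec_mem hK₃ hδ hq p.1 p.2)).contMDiffAt.comp p
    (contMDiff_draw_add_smul_pertVec hK hw q p)

/-- Each stage of the family is smooth. [folklore] -/
theorem contMDiff_gpFamily_stage {K : 𝕊 1 → 𝔼 4} (hK : IsModelKnot r K) (hw : ∀ t, wC (K t) ≠ 0)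
    {K₃ : Knot} (hK₃ : ⇑K₃ = finiteApprox r 0 K) {δ : ℝ}
    (hδ : ∀ (θ : ℝ) (v : (ℝ × ℝ) × ℝ), ‖v‖ < δ → K₃.stereoCurve θ + v ∈ pictureRegion r)
    {q : (ℝ × ℝ) × (ℝ × ℝ)} (hq : ‖q.1‖ + ‖q.2‖ < δ) (s : ℝ) :
    ContMDiff (𝓡 1) 𝓘(ℝ, 𝔼 4) ∞ (gpFamily r K q s) := by
  have hι : ContMDiff (𝓡 1) (𝓘(ℝ, ℝ).prod (𝓡 1)) ∞ (fun t : 𝕊 1 ↦ ((s, t) : ℝ × (𝕊 1))) :=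
    contMDiff_const.prodMk contMDiff_id
  have h := (contMDiff_gpFamily hK hw hK₃ hδ hq).comp hι
  simp only [Function.comp_def] at h
  exact h

/-- The stages lie in `M_r` and miss the cores; their pictures are the chart points.
[folklore] -/
theorem gpFamily_mem {K : 𝕊 1 → 𝔼 4} {K₃ : Knot} (hK₃ : ⇑K₃ = finiteApprox r 0 K) {δ : ℝ}
    (hδ : ∀ (θ : ℝ) (v : (ℝ × ℝ) × ℝ), ‖v‖ < δ → K₃.stereoCurve θ + v ∈ pictureRegion r)
    {q : (ℝ × ℝ) × (ℝ × ℝ)} (hq : ‖q.1‖ + ‖q.2‖ < δ) (s : ℝ) (t : 𝕊 1) :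
    gpFamily r K q s t ∈ modelBoundary r ∧ wC (gpFamily r K q s t) ≠ 0 ∧
      draw r (gpFamily r K q s t) = draw r (K t) + Real.smoothTransition s • pertVec q t :=
  ⟨chartLift_mem_modelBoundary (draw_add_smul_pertVec_mem hK₃ hδ hq s t),
    wC_chartLift_ne_zero (draw_add_smul_pertVec_mem hK₃ hδ hq s t),
    draw_chartLift (draw_add_smul_pertVec_mem hK₃ hδ hq s t)⟩


/-! ## The stages of the family are model knots -/

/-- **Ambient versus intrinsic velocity on the circle**: a smooth map `f : 𝕊¹ → ℝ⁴` whose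
velocity along `θ ↦ (cos θ, sin θ)` is nonzero at `θ` has injective differential at
`(cos θ, sin θ)` — the tangent line of `𝕊¹` there is spanned by the (nonzero) velocity of
`circlePoint`. [folklore] -/
theorem injective_mfderiv_of_deriv_comp_circlePoint_ne_zero {f : 𝕊 1 → 𝔼 4}
    (hf : ContMDiff (𝓡 1) 𝓘(ℝ, 𝔼 4) ∞ f) {θ : ℝ}
    (h : deriv (fun s ↦ f (circlePoint s)) θ ≠ 0) :
    Injective (mfderiv (𝓡 1) 𝓘(ℝ, 𝔼 4) f (circlePoint θ)) := by
  have hn : (∞ : WithTop ℕ∞) ≠ 0 := by simp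
  set L := mfderiv (𝓡 1) 𝓘(ℝ, 𝔼 4) f (circlePoint θ) with hL
  set D := mfderiv 𝓘(ℝ, ℝ) (𝓡 1) circlePoint θ with hD
  have hcomp : mfderiv 𝓘(ℝ, ℝ) 𝓘(ℝ, 𝔼 4) (f ∘ circlePoint) θ = L.comp D :=
    mfderiv_comp θ (hf.mdifferentiableAt hn) (contMDiff_circlePoint.mdifferentiableAt hn)
  have key : mfderiv 𝓘(ℝ, ℝ) 𝓘(ℝ, 𝔼 4) (f ∘ circlePoint) θ 1 = L (D 1) :=
    DFunLike.congr_fun hcomp 1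
  have e1 : mfderiv 𝓘(ℝ, ℝ) 𝓘(ℝ, 𝔼 4) (f ∘ circlePoint) θ 1 =
      deriv (fun s ↦ f (circlePoint s)) θ := by
    rw [mfderiv_eq_fderiv]
    rfl
  have h1 : L (D 1) ≠ 0 := by
    rw [← key, e1]
    exact h
  have hD1 : D 1 ≠ 0 := fun h0 ↦ h1 (by rw [h0, map_zero])
  have hdim : Module.finrank ℝ (TangentSpace (𝓡 1) (circlePoint θ)) = 1 :=
    finrank_euclideanSpace_fin
  intro v w hvw
  obtain ⟨a, ha⟩ := (finrank_eq_one_iff_of_nonzero' (D 1) hD1).1 hdim v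
  obtain ⟨b, hb⟩ := (finrank_eq_one_iff_of_nonzero' (D 1) hD1).1 hdim w
  rw [← ha, ← hb, map_smul, map_smul] at hvw
  have hab : (a - b) • L (D 1) = 0 := by rw [sub_smul, hvw, sub_self]
  rcases smul_eq_zero.1 hab with hab | hab
  · rw [← ha, ← hb, sub_eq_zero.1 hab]
  · exact absurd hab h1

/-- **The stages of the family are core-missing model knots** (for a perturbation below the
margin `δ` AND below the `C¹`-stability bound of the picture knot, hypothesis `hreg`): smooth;
injective and immersed because their pictures `draw ∘ H_s` are the regular simple closed chart
curves `pertFamily … (χ s)` and `draw` is smooth along them. [folklore] -/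
theorem isModelKnot_gpFamily {K : 𝕊 1 → 𝔼 4} (hK : IsModelKnot r K) (hw : ∀ t, wC (K t) ≠ 0)
    {K₃ : Knot} (hK₃ : ⇑K₃ = finiteApprox r 0 K) {δ : ℝ}
    (hδ : ∀ (θ : ℝ) (v : (ℝ × ℝ) × ℝ), ‖v‖ < δ → K₃.stereoCurve θ + v ∈ pictureRegion r)
    {q : (ℝ × ℝ) × (ℝ × ℝ)} (hq : ‖q.1‖ + ‖q.2‖ < δ)
    (hreg : ∀ u ∈ Icc (0 : ℝ) 1,
      (∀ θ, deriv (Knot.pertFamily K₃ (Knot.pertTerm K₃.planeCurve q) u) θ ≠ 0) ∧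
        ∀ s₁ s₂, Knot.pertFamily K₃ (Knot.pertTerm K₃.planeCurve q) u s₁ =
          Knot.pertFamily K₃ (Knot.pertTerm K₃.planeCurve q) u s₂ →
            circlePoint s₁ = circlePoint s₂)
    (s : ℝ) : IsModelKnot r (gpFamily r K q s) := by
  have hK₃0 : ∀ x, K₃ x ≠ northPole := ne_northPole_of_coe_eq_finiteApprox hK₃
  set u : ℝ := Real.smoothTransition s with hu
  have huI : u ∈ Icc (0 : ℝ) 1 := ⟨Real.smoothTransition.nonneg s, Real.smoothTransition.le_one s⟩
  set e : ℝ → (ℝ × ℝ) × ℝ := Knot.pertFamily K₃ (Knot.pertTerm K₃.planeCurve q) u with he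
  obtain ⟨hreg', hinj'⟩ := hreg u huI
  have hsmooth := contMDiff_gpFamily_stage hK hw hK₃ hδ hq s
  have hmem := gpFamily_mem hK₃ hδ hq s
  -- the pictures of the stage over an angle
  have hpic : ∀ θ, draw r (gpFamily r K q s (circlePoint θ)) = e θ := fun θ ↦ by
    rw [(hmem (circlePoint θ)).2.2, draw_add_smul_pertVec_circlePoint hK₃]
  have hemem : ∀ θ, e θ ∈ pictureRegion r := fun θ ↦ by
    rw [he, ← draw_add_smul_pertVec_circlePoint hK₃]
    exact draw_add_smul_pertVec_mem hK₃ hδ hq s _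
  refine ⟨hsmooth, ?_, fun t ↦ ?_, fun t ↦ (hmem t).1⟩
  · -- injective
    intro t₁ t₂ h12
    obtain ⟨θ₁, rfl⟩ := circlePoint_surjective t₁
    obtain ⟨θ₂, rfl⟩ := circlePoint_surjective t₂
    have h' := congrArg (draw r) h12
    rw [hpic, hpic] at h'
    exact hinj' θ₁ θ₂ h'
  · -- immersed
    obtain ⟨θ, rfl⟩ := circlePoint_surjective t
    refine injective_mfderiv_of_deriv_comp_circlePoint_ne_zero hsmooth fun h0 ↦ ?_
    -- `g = H_s ∘ circlePoint = chartLift ∘ e`, with `draw ∘ g = e`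
    have hg : (fun θ' ↦ gpFamily r K q s (circlePoint θ')) = fun θ' ↦ chartLift r (e θ') :=
      funext fun θ' ↦ gpFamily_circlePoint hK₃ q s θ'
    have hed : Differentiable ℝ e :=
      (Knot.contDiff_pertFamily hK₃0 (Knot.contDiff_pertTerm hK₃0 q) u).differentiable (by simp)
    have hgd : DifferentiableAt ℝ (fun θ' ↦ chartLift r (e θ')) θ :=
      ((contDiffAt_chartLift (hemem θ)).differentiableAt (by simp)).comp θ (hed θ)
    have hgd' : DifferentiableAt ℝ (fun θ' ↦ gpFamily r K q s (circlePoint θ')) θ := by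
      rw [hg]; exact hgd
    have hgder : HasDerivAt (fun θ' ↦ chartLift r (e θ')) 0 θ := by
      have h' := hgd'.hasDerivAt
      rw [h0] at h'
      rw [hg] at h'
      exact h'
    have hdraw : DifferentiableAt ℝ (draw r) (chartLift r (e θ)) :=
      (contDiffAt_draw (wC_chartLift_ne_zero (hemem θ)) (n := 1)).differentiableAt one_ne_zero
    have hcomp := hdraw.hasFDerivAt.comp_hasDerivAt θ hgder
    rw [map_zero] at hcomp
    have hfun : (draw r ∘ fun θ' ↦ chartLift r (e θ')) = e :=
      funext fun θ' ↦ draw_chartLift (hemem θ')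
    rw [hfun] at hcomp
    exact hreg' θ hcomp.deriv

/-! ## General position of the picture, within the core-missing model isotopy class -/

/-- **The general-position family of a core-missing model knot.**  For a generic small
first-harmonic parameter `q` (below the margin of the picture region and the `C¹`-stability bound
of the picture knot, and outside the Lebesgue-null bad sets of `exists_pert_generic`), the family
`gpFamily r K q` is a jointly smooth family of core-missing model knots starting at `K`, and the
standard picture `D(0⃗)` of its end stage is a knot of the tree **in general position**
(`Knot.InGeneralPosition`), namely the perturbed knot `Knot.pertKnot` of the picture knot of `K`.
[cite: ManolescuMarengonSarkarWillis2023, §8.1; HirschDT1976, Ch. 3 Thm. 2.4] -/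
theorem IsModelKnot.exists_gpFamily_inGeneralPosition {K : 𝕊 1 → 𝔼 4} (hK : IsModelKnot r K)
    (hw : ∀ t, wC (K t) ≠ 0) :
    ∃ (q : (ℝ × ℝ) × (ℝ × ℝ)) (K₃' : Knot),
      ContMDiff (𝓘(ℝ, ℝ).prod (𝓡 1)) 𝓘(ℝ, 𝔼 4) ∞
          (fun p : ℝ × (𝕊 1) ↦ gpFamily r K q p.1 p.2) ∧
        (∀ s, IsModelKnot r (gpFamily r K q s)) ∧ (∀ s t, wC (gpFamily r K q s t) ≠ 0) ∧
          ⇑K₃' = finiteApprox r 0 (gpFamily r K q 1) ∧ K₃'.InGeneralPosition := by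
  obtain ⟨K₃, hK₃⟩ := hK.exists_knot_coe_eq_finiteApprox hw 0
  have hK₃0 : ∀ x, K₃ x ≠ northPole := ne_northPole_of_coe_eq_finiteApprox hK₃
  obtain ⟨δ, hδ, hδmem⟩ := exists_forall_stereoCurve_add_mem hK hw hK₃
  obtain ⟨ε, hε, hall⟩ := Knot.exists_forall_pertFamily_regular hK₃0
  have hγ : ContDiff ℝ ∞ K₃.planeCurve := Knot.contDiff_planeCurve hK₃0
  obtain ⟨q, hq, himm, htrans, htriple⟩ := exists_pert_generic hγ (lt_min hε hδ)
  have hqε : ‖q.1‖ + ‖q.2‖ < ε := lt_of_lt_of_le hq (min_le_left _ _)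
  have hqδ : ‖q.1‖ + ‖q.2‖ < δ := lt_of_lt_of_le hq (min_le_right _ _)
  set P := Knot.pertTerm K₃.planeCurve q with hP
  have hPs : ContDiff ℝ ∞ P := Knot.contDiff_pertTerm hK₃0 q
  have hPper : Periodic P (2 * Real.pi) := Knot.periodic_pertTerm K₃ q
  have hP0 : ∀ θ, ‖P θ‖ ≤ ε := fun θ ↦ (Knot.norm_pertTerm_le K₃ q θ).trans hqε.le
  have hP1 : ∀ θ, ‖deriv P θ‖ ≤ ε := fun θ ↦ (Knot.norm_deriv_pertTerm_le hK₃0 q θ).trans hqε.le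
  have hallP := hall P hPs hPper hP0 hP1
  -- the end stage in the chart: the perturbed knot
  have hreg1 : ∀ θ, deriv (fun θ ↦ K₃.stereoCurve θ + P θ) θ ≠ 0 := by
    have := (hallP 1 ⟨zero_le_one, le_rfl⟩).1
    rwa [Knot.pertFamily_one] at this
  have hinj1 : ∀ s t, K₃.stereoCurve s + P s = K₃.stereoCurve t + P t →
      circlePoint s = circlePoint t := by
    have := (hallP 1 ⟨zero_le_one, le_rfl⟩).2
    rwa [Knot.pertFamily_one] at this
  set K₃' : Knot := Knot.pertKnot hK₃0 hPs hPper hreg1 hinj1 with hK₃'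
  have hK₃'0 : ∀ x, K₃' x ≠ northPole := Knot.pertKnot_ne_northPole hK₃0 hPs hPper hreg1 hinj1
  have hcurve : K₃'.stereoCurve = fun θ ↦ K₃.stereoCurve θ + P θ :=
    Knot.stereoCurve_pertKnot hK₃0 hPs hPper hreg1 hinj1
  refine ⟨q, K₃', contMDiff_gpFamily hK hw hK₃ hδmem hqδ,
    fun s ↦ isModelKnot_gpFamily hK hw hK₃ hδmem hqδ hallP s,
    fun s t ↦ (gpFamily_mem hK₃ hδmem hqδ s t).2.1, ?_, ?_⟩
  · -- the picture of the end stage is the perturbed knot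
    funext t
    obtain ⟨θ, rfl⟩ := circlePoint_surjective t
    have h1 : K₃' (circlePoint θ) = stereoNorthInv (K₃.stereoCurve θ + P θ) := by
      rw [← stereoNorthInv_stereoNorthCoords (hK₃'0 (circlePoint θ)), ← SphereEmbedding.curve_apply,
        ← Knot.stereoCurve_apply, hcurve]
    have h2 : draw r (gpFamily r K q 1 (circlePoint θ)) = K₃.stereoCurve θ + P θ := by
      rw [(gpFamily_mem hK₃ hδmem hqδ 1 (circlePoint θ)).2.2,
        Real.smoothTransition.one_of_one_le le_rfl, one_smul, stereoCurve_eq_draw hK₃,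
        pertVec_circlePoint K₃.planeCurve]
    rw [h1, finiteApprox_zero_apply, h2, toSphereThree_eq_stereoNorthInv]
  · -- general position of the perturbed knot
    have hplane : K₃'.planeCurve = pert K₃.planeCurve q := by
      funext θ
      rw [Knot.planeCurve_eq_fst_comp, comp_apply, hcurve]
      show (K₃.stereoCurve θ + Knot.pertTerm K₃.planeCurve q θ).1 = pert K₃.planeCurve q θ
      rw [Knot.stereoCurve_add_pertTerm]
    exact Knot.inGeneralPosition_of_generic hK₃'0 hγ hplane himm htrans htriple

/-- **General position of the standard picture, up to core-missing model isotopy** (MMSW §8.1,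
first step: "draw the link in the standard picture in general position").  Every model knot
`K ⊂ M_r` missing the cores is the start `H 0 = K` of a collared, jointly smooth family
`H : ℝ × 𝕊¹ → ℝ⁴` of core-missing model knots whose end stage `K' = H 1` has standard picture
`D(0⃗)(K') = ⇑K₃'` for a knot `K₃'` of the tree in general position with respect to the
stereographic projection; in particular `K` and `K'` are smoothly isotopic model knots
(`IsSmoothModelIsotopy`), and ALL their finite approximations have the same Rasmussen invariants
(`approxHasRasmussen_iff_of_isotopy`).
[cite: ManolescuMarengonSarkarWillis2023, §8.1; Cromwell2004, Thm. 3.2.1] -/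
theorem IsModelKnot.exists_isotopy_inGeneralPosition {K : 𝕊 1 → 𝔼 4} (hK : IsModelKnot r K)
    (hw : ∀ t, wC (K t) ≠ 0) :
    ∃ (H : ℝ → (𝕊 1) → 𝔼 4) (K₃' : Knot),
      ContMDiff (𝓘(ℝ, ℝ).prod (𝓡 1)) 𝓘(ℝ, 𝔼 4) ∞ (fun p : ℝ × (𝕊 1) ↦ H p.1 p.2) ∧
        (∀ s, s ≤ 0 → H s = K) ∧ (∀ s, 1 ≤ s → H s = H 1) ∧
          (∀ s, IsModelKnot r (H s)) ∧ (∀ s t, wC (H s t) ≠ 0) ∧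
            ⇑K₃' = finiteApprox r 0 (H 1) ∧ K₃'.InGeneralPosition := by
  obtain ⟨q, K₃', hH, hmk, hwH, hpic, hgp⟩ := hK.exists_gpFamily_inGeneralPosition hw
  exact ⟨gpFamily r K q, K₃', hH, fun s hs ↦ gpFamily_of_nonpos hK hw q hs,
    fun s hs ↦ gpFamily_of_one_le K q hs, hmk, hwH, hpic, hgp⟩

/-- **Corollary: a core-missing model knot is smoothly model-isotopic, through core-missing
knots, to one whose standard picture is in general position, with the same Rasmussen invariants
of all finite approximations `D(k⃗)`.** [cite: ManolescuMarengonSarkarWillis2023, §8.1 and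
Prop. 8.2 (i)] -/
theorem IsModelKnot.exists_isSmoothModelIsotopy_inGeneralPosition {K : 𝕊 1 → 𝔼 4}
    (hK : IsModelKnot r K) (hw : ∀ t, wC (K t) ≠ 0) :
    ∃ K' : (𝕊 1) → 𝔼 4, IsSmoothModelIsotopy r K K' ∧ IsModelKnot r K' ∧ (∀ t, wC (K' t) ≠ 0) ∧
      (∀ (k : ℤ) (s : ℤ), ApproxHasRasmussen r k K s ↔ ApproxHasRasmussen r k K' s) ∧
        ∃ K₃' : Knot, ⇑K₃' = finiteApprox r 0 K' ∧ K₃'.InGeneralPosition := by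
  obtain ⟨H, K₃', hH, h0, h1, hmk, hwH, hpic, hgp⟩ := hK.exists_isotopy_inGeneralPosition hw
  refine ⟨H 1, ⟨H, hH, h0, h1, hmk⟩, hmk 1, hwH 1, fun k s ↦ ?_, K₃', hpic, hgp⟩
  exact approxHasRasmussen_iff_of_isotopy hH (h0 0 le_rfl) rfl hmk hwH k s

end MMSW

end Literature.Topology.FourManifolds

end
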